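import Summits.Ventures.Crystal3D.Theorems.StickyWulffConstantPolycrystalWulffBoundGenericShift

/-!
# `PolycrystalWulffBound`, line `PolyDensity`: the RADIAL MASS of the crux's Wulff body inside the
# ball of radius `2`, and the symmetric-piece inequalities (crux `stmt-Ventures-19482`; input of the
# generic cdf shift `3/5`, decision thread L-2 of cf-p1 §87.0)

Route `StickyWulffConstant` of the venture `Summits/Ventures/Crystal3D`, second prover lane (poly-p2,
gen 15).  Rotation-invariant facts about `W(X)` (any frame `X`) beyond the ball sandwich
`B̄(0,√3) ⊆ W(X) ⊆ B̄(0,√5)`, `|W(X)| = 32`, `−W(X) = W(X)` used by gen 14's `θ = 1` shift lemma: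

* `volume_cruxWulffBody_inter_closedBall_two_ge` : **`|W(X) ∩ B̄(0,2)| ≥ π(24√3 − 32) ≈ 30.06`** —
  in cubic coordinates (`W_cubic = {‖y‖_∞ ≤ 2} ∩ {‖y‖₁ ≤ 3}`, `fccWulffBody_eq_truncOct`) a point of
  `B̄(0,2)` outside `W` has `‖y‖₁ > 3`, i.e. lies in the ball cap `{√3 < ⟪y, s/√3⟫}` of its sign
  vector `s`; the eight caps have volume `π(16/3 − 3√3)` each (`volume_closedBall_inter_ioi`) and
  `|B̄(0,2)| = 32π/3`;
* `two_mul_volume_inter_ioi_le_of_symm` / `volume_le_two_mul_add_band_of_symm` : for a centrally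
  symmetric `S` and `q ≥ 0`, `2|S ∩ {q < ⟪y,n⟫}| ≤ |S| ≤ 2|S ∩ {q < ⟪y,n⟫}| + |S ∩ {|⟪y,n⟫| ≤ q}|`;
* `volume_closedBall_band_add` : band + two caps = ball.

These feed the two-shell envelopes of the cap profile (`…GenericShiftShells`) and the generic shift
`θ = 3/5` (`…GenericShiftThreeFifths`); memo P-L2-g15.
WHAT THIS IS NOT: anything direction-resolved about `W`; the crux is not claimed.
-/
noncomputable section

open scoped BigOperators InnerProductSpace ENNReal Pointwise
open MeasureTheory Set

namespace Summit.Ventures.Crystal3D.Theorems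

open Summit.Ventures.Crystal3D.Cruxes.TextureLiminf.TexShadow (E3)

open Literature.MathematicalPhysics.StatisticalMechanics (fccStacking fccWulffBody mem_fccWulffBody_iff
  isCompact_fccWulffBody)

/-! ### Balls in `ℝ³`: volume, empty caps -/

/-- `|B̄(0,R)| = (4/3)·π·R³` in `ℝ³`. -/
theorem volume_closedBall_zero_E3 {R : ℝ} (hR : 0 ≤ R) :
    volume (Metric.closedBall (0 : E3) R) = ENNReal.ofReal (4 / 3 * Real.pi * R ^ 3) := by
  rw [EuclideanSpace.volume_closedBall_fin_three, ← ENNReal.ofReal_pow hR,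
    ← ENNReal.ofReal_mul (pow_nonneg hR 3)]
  congr 1; ring

/-- A ball cap above the top of the ball is empty. -/
theorem volume_closedBall_inter_ioi_eq_zero {n : E3} (hn : ‖n‖ = 1) {R τ : ℝ} (hRτ : R ≤ τ) :
    volume (Metric.closedBall (0 : E3) R ∩ {y : E3 | τ < ⟪y, n⟫_ℝ}) = 0 := by
  have h : Metric.closedBall (0 : E3) R ∩ {y : E3 | τ < ⟪y, n⟫_ℝ} = ∅ := by
    ext y
    simp only [mem_inter_iff, Metric.mem_closedBall, dist_zero_right, mem_setOf_eq,
      mem_empty_iff_false, iff_false, not_and, not_lt]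
    intro hy
    have h1 : ⟪y, n⟫_ℝ ≤ ‖y‖ * ‖n‖ := real_inner_le_norm _ _
    rw [hn, mul_one] at h1
    linarith
  rw [h, measure_empty]

/-! ### The mass of the Wulff body inside the ball of radius `2` -/

/-- In cubic coordinates: `|W_cubic ∩ B̄(0,2)| ≥ π(24√3 − 32)`, `W_cubic = conv{perm(0,±1,±2)} =
{‖y‖_∞ ≤ 2} ∩ {‖y‖₁ ≤ 3}`.  A point of `B̄(0,2)` outside `W_cubic` has `‖y‖₁ > 3`, i.e. lies in
the ball cap `{√3 < ⟪y, s/√3⟫}` of its sign vector `s ∈ {±1}³`; the eight caps have volume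
`π(16/3 − 3√3)` each and `|B̄(0,2)| = 32π/3`. -/
theorem volume_fccWulffBody_inter_closedBall_two_ge :
    ENNReal.ofReal (Real.pi * (24 * Real.sqrt 3 - 32)) ≤
      volume (fccWulffBody ∩ Metric.closedBall (0 : E3) 2) := by
  have h3pos : 0 < Real.sqrt 3 := Real.sqrt_pos.2 (by norm_num)
  have h3sq : Real.sqrt 3 ^ 2 = 3 := Real.sq_sqrt (by norm_num)
  have h3le2 : Real.sqrt 3 ≤ 2 := by
    rw [Real.sqrt_le_left (by norm_num)]; norm_num
  -- the eight unit normals `u σ = (±1,±1,±1)/√3`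
  set u : (Fin 3 → Bool) → E3 := fun σ =>
    WithLp.toLp 2 fun i => if σ i then (Real.sqrt 3)⁻¹ else -(Real.sqrt 3)⁻¹ with hu
  have huapp : ∀ σ i, u σ i = if σ i then (Real.sqrt 3)⁻¹ else -(Real.sqrt 3)⁻¹ := fun σ i => rfl
  have husq : ∀ σ i, ‖u σ i‖ ^ 2 = 1 / 3 := by
    intro σ i
    rw [huapp, Real.norm_eq_abs, sq_abs]
    split_ifs
    · rw [inv_pow, h3sq]; norm_num
    · rw [neg_sq, inv_pow, h3sq]; norm_num
  have hunorm : ∀ σ, ‖u σ‖ = 1 := by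
    intro σ
    rw [EuclideanSpace.norm_eq, Fin.sum_univ_three, husq, husq, husq]
    norm_num
  -- the cover
  set cap : (Fin 3 → Bool) → Set E3 := fun σ =>
    Metric.closedBall (0 : E3) 2 ∩ {y : E3 | Real.sqrt 3 < ⟪y, u σ⟫_ℝ} with hcap
  have hcover : Metric.closedBall (0 : E3) 2 ⊆
      (fccWulffBody ∩ Metric.closedBall (0 : E3) 2) ∪ ⋃ σ, cap σ := by
    intro y hy
    by_cases hyW : y ∈ fccWulffBody
    · exact Or.inl ⟨hyW, hy⟩
    right
    have hy2 : ‖y‖ ≤ 2 := mem_closedBall_zero_iff.1 hy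
    rw [mem_fccWulffBody_iff] at hyW
    have hcoordle : ∀ i, |y i| ≤ ‖y‖ := by  -- (the tree has this as `Literature.Barriers…abs_apply_le_norm_E3`)
      intro i
      rw [EuclideanSpace.norm_eq]
      refine Real.le_sqrt_of_sq_le ?_
      have h : ‖y i‖ ^ 2 ≤ ∑ j, ‖y j‖ ^ 2 :=
        Finset.single_le_sum (f := fun j => ‖y j‖ ^ 2) (fun j _ => sq_nonneg _) (Finset.mem_univ i)
      simpa [Real.norm_eq_abs, sq_abs] using h
    have hcoord : ∀ i, |y i| ≤ 2 := fun i => (hcoordle i).trans hy2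
    have hsum : 3 < ∑ i, |y i| := by
      by_contra hcon
      exact hyW ⟨hcoord, not_lt.1 hcon⟩
    set σ : Fin 3 → Bool := fun i => decide (0 ≤ y i) with hσ
    have hys : ∀ j, y j * u σ j = (Real.sqrt 3)⁻¹ * |y j| := by
      intro j
      rw [huapp]
      by_cases hj : 0 ≤ y j
      · have : σ j = true := by rw [hσ]; exact decide_eq_true hj
        rw [if_pos this, abs_of_nonneg hj]; ring
      · have : σ j = false := by rw [hσ]; exact decide_eq_false hj
        rw [this, abs_of_neg (lt_of_not_ge hj)]; simp; ring
    have hinner : ⟪y, u σ⟫_ℝ = (Real.sqrt 3)⁻¹ * ∑ j, |y j| := by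
      have e : ⟪y, u σ⟫_ℝ = y 0 * u σ 0 + y 1 * u σ 1 + y 2 * u σ 2 := by
        simp [EuclideanSpace.inner_eq_star_dotProduct, dotProduct, Fin.sum_univ_three, mul_comm]
      rw [e, hys, hys, hys, Fin.sum_univ_three]; ring
    refine mem_iUnion.2 ⟨σ, hy, ?_⟩
    show Real.sqrt 3 < ⟪y, u σ⟫_ℝ
    rw [hinner]
    have e3 : (Real.sqrt 3)⁻¹ * 3 = Real.sqrt 3 := by
      rw [inv_mul_eq_iff_eq_mul₀ h3pos.ne', ← sq, h3sq]
    calc Real.sqrt 3 = (Real.sqrt 3)⁻¹ * 3 := e3.symm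
      _ < (Real.sqrt 3)⁻¹ * ∑ j, |y j| := mul_lt_mul_of_pos_left hsum (inv_pos.2 h3pos)
  -- volumes
  have hcapvol : ∀ σ, volume (cap σ) =
      ENNReal.ofReal (Real.pi * (2 * 2 ^ 3 / 3 - 2 ^ 2 * Real.sqrt 3 + Real.sqrt 3 ^ 3 / 3)) :=
    fun σ => volume_closedBall_inter_ioi (hunorm σ) two_pos h3le2 (by linarith)
  have h3cube : Real.sqrt 3 ^ 3 = 3 * Real.sqrt 3 := by rw [pow_succ, h3sq]
  have hcapreal : Real.pi * (2 * 2 ^ 3 / 3 - 2 ^ 2 * Real.sqrt 3 + Real.sqrt 3 ^ 3 / 3) =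
      Real.pi * (16 / 3 - 3 * Real.sqrt 3) := by rw [h3cube]; ring
  have hcap0 : 0 ≤ Real.pi * (16 / 3 - 3 * Real.sqrt 3) := by
    have : (1.732 : ℝ) < Real.sqrt 3 := by rw [Real.lt_sqrt (by norm_num)]; norm_num
    have h2 : Real.sqrt 3 < (1.7321 : ℝ) := by rw [Real.sqrt_lt' (by norm_num)]; norm_num
    nlinarith [Real.pi_pos]
  have hball : volume (Metric.closedBall (0 : E3) 2) = ENNReal.ofReal (Real.pi * (32 / 3)) := by
    rw [volume_closedBall_zero_E3 (by norm_num : (0:ℝ) ≤ 2)]; congr 1; ring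
  have hkey : ENNReal.ofReal (Real.pi * (32 / 3)) ≤
      volume (fccWulffBody ∩ Metric.closedBall (0 : E3) 2) +
        ENNReal.ofReal (8 * (Real.pi * (16 / 3 - 3 * Real.sqrt 3))) := by
    calc ENNReal.ofReal (Real.pi * (32 / 3)) = volume (Metric.closedBall (0 : E3) 2) := hball.symm
      _ ≤ volume ((fccWulffBody ∩ Metric.closedBall (0 : E3) 2) ∪ ⋃ σ, cap σ) :=
          measure_mono hcover
      _ ≤ volume (fccWulffBody ∩ Metric.closedBall (0 : E3) 2) + volume (⋃ σ, cap σ) :=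
          measure_union_le _ _
      _ ≤ volume (fccWulffBody ∩ Metric.closedBall (0 : E3) 2) + ∑ σ, volume (cap σ) := by
          gcongr
          exact (measure_iUnion_le _).trans (by rw [tsum_fintype])
      _ = volume (fccWulffBody ∩ Metric.closedBall (0 : E3) 2) +
          ENNReal.ofReal (8 * (Real.pi * (16 / 3 - 3 * Real.sqrt 3))) := by
          congr 1
          simp_rw [hcapvol, hcapreal]
          rw [Finset.sum_const, Finset.card_univ, Fintype.card_fun, Fintype.card_bool,
            Fintype.card_fin, nsmul_eq_mul, ENNReal.ofReal_mul (by norm_num : (0:ℝ) ≤ 8)]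
          norm_num
  have hsub : ENNReal.ofReal (Real.pi * (24 * Real.sqrt 3 - 32)) =
      ENNReal.ofReal (Real.pi * (32 / 3)) -
        ENNReal.ofReal (8 * (Real.pi * (16 / 3 - 3 * Real.sqrt 3))) := by
    rw [← ENNReal.ofReal_sub _ (mul_nonneg (by norm_num) hcap0)]
    congr 1; ring
  rw [hsub]
  exact tsub_le_iff_right.2 hkey

/-- **Mass inside radius 2.** For every frame `X`: `|W(X) ∩ B̄(0,2)| ≥ π(24√3 − 32) ≈ 30.06`
(`W(X)` is an isometric image of `W_cubic`, and isometries fix the centred balls). -/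
theorem volume_cruxWulffBody_inter_closedBall_two_ge (X : E3 ≃ₗᵢ[ℝ] E3) :
    ENNReal.ofReal (Real.pi * (24 * Real.sqrt 3 - 32)) ≤
      volume ({y : E3 | ∀ ν : E3, ⟪y, ν⟫_ℝ ≤ Real.sqrt 2 / 4 *
        ∑ᶠ w ∈ {w | w ∈ fccStacking 1 (Real.sqrt (2 / 3)) ∧ ‖w‖ = 1}, |⟪w, X.symm ν⟫_ℝ|} ∩
        Metric.closedBall (0 : E3) 2) := by
  obtain ⟨L, hL⟩ := exists_linearIsometryEquiv_unitShell_eq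
  rw [cruxWulffBody_eq_image_fccWulffBody hL X]
  set Φ : E3 ≃ₗᵢ[ℝ] E3 := L.trans X with hΦ
  have himage : Φ '' fccWulffBody ∩ Metric.closedBall (0 : E3) 2 =
      Φ '' (fccWulffBody ∩ Metric.closedBall (0 : E3) 2) := by
    ext y
    simp only [mem_inter_iff, mem_image, Metric.mem_closedBall, dist_zero_right]
    constructor
    · rintro ⟨⟨x, hx, rfl⟩, hy⟩
      exact ⟨x, ⟨hx, by rwa [LinearIsometryEquiv.norm_map] at hy⟩, rfl⟩
    · rintro ⟨x, ⟨hx, hx2⟩, rfl⟩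
      exact ⟨⟨x, hx, rfl⟩, by rwa [LinearIsometryEquiv.norm_map]⟩
  have hmeas : MeasurableSet (fccWulffBody ∩ Metric.closedBall (0 : E3) 2) :=
    isCompact_fccWulffBody.isClosed.measurableSet.inter Metric.isClosed_closedBall.measurableSet
  rw [himage, LinearIsometryEquiv.image_eq_preimage_symm,
    Φ.symm.measurePreserving.measure_preimage hmeas.nullMeasurableSet]
  exact volume_fccWulffBody_inter_closedBall_two_ge

/-! ### Symmetric pieces: halves above a nonnegative level -/

/-- For a centrally symmetric set `S` and `q ≥ 0`: `S ∩ {q < ⟪y,n⟫}` and its antipode are disjoint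
in `S`, so `2·|S ∩ {q < ⟪y,n⟫}| ≤ |S|`. -/
theorem two_mul_volume_inter_ioi_le_of_symm {S : Set E3} (hS : -S = S) (hSm : MeasurableSet S)
    (n : E3) {q : ℝ} (hq : 0 ≤ q) :
    2 * volume (S ∩ {y : E3 | q < ⟪y, n⟫_ℝ}) ≤ volume S := by
  have hneg : S ∩ {y : E3 | ⟪y, n⟫_ℝ < -q} = -(S ∩ {y : E3 | q < ⟪y, n⟫_ℝ}) := by
    ext y
    simp only [mem_inter_iff, mem_setOf_eq, Set.mem_neg, inner_neg_left]
    constructor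
    · rintro ⟨hy, h⟩
      exact ⟨by rw [← hS] at hy; exact hy, by linarith⟩
    · rintro ⟨hy, h⟩
      refine ⟨?_, by linarith⟩
      have h2 : y ∈ -S := hy
      rwa [hS] at h2
  have hvol : volume (S ∩ {y : E3 | ⟪y, n⟫_ℝ < -q}) = volume (S ∩ {y : E3 | q < ⟪y, n⟫_ℝ}) := by
    rw [hneg, Measure.measure_neg]
  have hdisj : Disjoint (S ∩ {y : E3 | q < ⟪y, n⟫_ℝ}) (S ∩ {y : E3 | ⟪y, n⟫_ℝ < -q}) := by
    rw [Set.disjoint_left]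
    rintro y ⟨-, h1⟩ ⟨-, h2⟩
    have h1' : q < ⟪y, n⟫_ℝ := h1
    have h2' : ⟪y, n⟫_ℝ < -q := h2
    linarith
  have hm2 : MeasurableSet (S ∩ {y : E3 | ⟪y, n⟫_ℝ < -q}) :=
    hSm.inter (measurableSet_lt (measurable_id.inner measurable_const) measurable_const)
  calc 2 * volume (S ∩ {y : E3 | q < ⟪y, n⟫_ℝ})
      = volume (S ∩ {y : E3 | q < ⟪y, n⟫_ℝ}) + volume (S ∩ {y : E3 | ⟪y, n⟫_ℝ < -q}) := by
        rw [two_mul, hvol]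
    _ = volume ((S ∩ {y : E3 | q < ⟪y, n⟫_ℝ}) ∪ (S ∩ {y : E3 | ⟪y, n⟫_ℝ < -q})) :=
        (measure_union hdisj hm2).symm
    _ ≤ volume S := measure_mono (union_subset inter_subset_left inter_subset_left)

/-- For a centrally symmetric set `S` and `q ≥ 0`: `S` is covered by `S ∩ {q < ⟪y,n⟫}`, its antipode
and the band `S ∩ {|⟪y,n⟫| ≤ q}`, so `|S| ≤ 2·|S ∩ {q < ⟪y,n⟫}| + |S ∩ {−q ≤ ⟪y,n⟫ ≤ q}|`. -/
theorem volume_le_two_mul_add_band_of_symm {S : Set E3} (hS : -S = S) (n : E3) (q : ℝ) :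
    volume S ≤ 2 * volume (S ∩ {y : E3 | q < ⟪y, n⟫_ℝ}) +
      volume (S ∩ {y : E3 | -q ≤ ⟪y, n⟫_ℝ ∧ ⟪y, n⟫_ℝ ≤ q}) := by
  have hneg : S ∩ {y : E3 | ⟪y, n⟫_ℝ < -q} = -(S ∩ {y : E3 | q < ⟪y, n⟫_ℝ}) := by
    ext y
    simp only [mem_inter_iff, mem_setOf_eq, Set.mem_neg, inner_neg_left]
    constructor
    · rintro ⟨hy, h⟩
      exact ⟨by rw [← hS] at hy; exact hy, by linarith⟩
    · rintro ⟨hy, h⟩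
      refine ⟨?_, by linarith⟩
      have h2 : y ∈ -S := hy
      rwa [hS] at h2
  have hvol : volume (S ∩ {y : E3 | ⟪y, n⟫_ℝ < -q}) = volume (S ∩ {y : E3 | q < ⟪y, n⟫_ℝ}) := by
    rw [hneg, Measure.measure_neg]
  have hcov : S ⊆ (S ∩ {y : E3 | q < ⟪y, n⟫_ℝ}) ∪ (S ∩ {y : E3 | ⟪y, n⟫_ℝ < -q}) ∪
      (S ∩ {y : E3 | -q ≤ ⟪y, n⟫_ℝ ∧ ⟪y, n⟫_ℝ ≤ q}) := by
    intro y hy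
    by_cases h1 : q < ⟪y, n⟫_ℝ
    · exact Or.inl (Or.inl ⟨hy, h1⟩)
    by_cases h2 : ⟪y, n⟫_ℝ < -q
    · exact Or.inl (Or.inr ⟨hy, h2⟩)
    · exact Or.inr ⟨hy, not_lt.1 h2, not_lt.1 h1⟩
  calc volume S ≤ volume ((S ∩ {y : E3 | q < ⟪y, n⟫_ℝ}) ∪ (S ∩ {y : E3 | ⟪y, n⟫_ℝ < -q})) +
        volume (S ∩ {y : E3 | -q ≤ ⟪y, n⟫_ℝ ∧ ⟪y, n⟫_ℝ ≤ q}) :=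
        (measure_mono hcov).trans (measure_union_le _ _)
    _ ≤ volume (S ∩ {y : E3 | q < ⟪y, n⟫_ℝ}) + volume (S ∩ {y : E3 | ⟪y, n⟫_ℝ < -q}) +
        volume (S ∩ {y : E3 | -q ≤ ⟪y, n⟫_ℝ ∧ ⟪y, n⟫_ℝ ≤ q}) := by
        gcongr; exact measure_union_le _ _
    _ = 2 * volume (S ∩ {y : E3 | q < ⟪y, n⟫_ℝ}) +
        volume (S ∩ {y : E3 | -q ≤ ⟪y, n⟫_ℝ ∧ ⟪y, n⟫_ℝ ≤ q}) := by rw [hvol, two_mul]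

/-- The centred closed ball is centrally symmetric. -/
theorem neg_closedBall_zero_E3 (R : ℝ) : -Metric.closedBall (0 : E3) R = Metric.closedBall (0 : E3) R := by
  ext y
  simp only [Set.mem_neg, Metric.mem_closedBall, dist_zero_right, norm_neg]

/-- The band of a ball: `|B̄(0,R) ∩ {−q ≤ ⟪y,n⟫ ≤ q}| + 2·|B̄(0,R) ∩ {q < ⟪y,n⟫}| = |B̄(0,R)|`
for `q ≥ 0` (the three pieces partition the ball; the two caps have equal volume). -/
theorem volume_closedBall_band_add (n : E3) (R : ℝ) {q : ℝ} (hq : 0 ≤ q) :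
    volume (Metric.closedBall (0 : E3) R ∩ {y : E3 | -q ≤ ⟪y, n⟫_ℝ ∧ ⟪y, n⟫_ℝ ≤ q}) +
      2 * volume (Metric.closedBall (0 : E3) R ∩ {y : E3 | q < ⟪y, n⟫_ℝ}) =
        volume (Metric.closedBall (0 : E3) R) := by
  set B : Set E3 := Metric.closedBall (0 : E3) R with hB
  have hBneg : -B = B := neg_closedBall_zero_E3 R
  have hBm : MeasurableSet B := Metric.isClosed_closedBall.measurableSet
  have hneg : B ∩ {y : E3 | ⟪y, n⟫_ℝ < -q} = -(B ∩ {y : E3 | q < ⟪y, n⟫_ℝ}) := by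
    ext y
    simp only [mem_inter_iff, mem_setOf_eq, Set.mem_neg, inner_neg_left]
    constructor
    · rintro ⟨hy, h⟩
      exact ⟨by rw [← hBneg] at hy; exact hy, by linarith⟩
    · rintro ⟨hy, h⟩
      refine ⟨?_, by linarith⟩
      have h2 : y ∈ -B := hy
      rwa [hBneg] at h2
  have hvol : volume (B ∩ {y : E3 | ⟪y, n⟫_ℝ < -q}) = volume (B ∩ {y : E3 | q < ⟪y, n⟫_ℝ}) := by
    rw [hneg, Measure.measure_neg]
  have hm1 : MeasurableSet (B ∩ {y : E3 | q < ⟪y, n⟫_ℝ}) :=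
    hBm.inter (measurableSet_lt measurable_const (measurable_id.inner measurable_const))
  have hm2 : MeasurableSet (B ∩ {y : E3 | ⟪y, n⟫_ℝ < -q}) :=
    hBm.inter (measurableSet_lt (measurable_id.inner measurable_const) measurable_const)
  have hd1 : Disjoint (B ∩ {y : E3 | -q ≤ ⟪y, n⟫_ℝ ∧ ⟪y, n⟫_ℝ ≤ q}) (B ∩ {y : E3 | q < ⟪y, n⟫_ℝ}) := by
    rw [Set.disjoint_left]
    rintro y ⟨-, -, h1⟩ ⟨-, h2⟩
    have h2' : q < ⟪y, n⟫_ℝ := h2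
    linarith
  have hd2 : Disjoint ((B ∩ {y : E3 | -q ≤ ⟪y, n⟫_ℝ ∧ ⟪y, n⟫_ℝ ≤ q}) ∪ (B ∩ {y : E3 | q < ⟪y, n⟫_ℝ}))
      (B ∩ {y : E3 | ⟪y, n⟫_ℝ < -q}) := by
    rw [Set.disjoint_left]
    rintro y (⟨-, h1, -⟩ | ⟨-, h1⟩) ⟨-, h2⟩
    · have h2' : ⟪y, n⟫_ℝ < -q := h2
      linarith
    · have h1' : q < ⟪y, n⟫_ℝ := h1
      have h2' : ⟪y, n⟫_ℝ < -q := h2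
      linarith
  have hpart : B = ((B ∩ {y : E3 | -q ≤ ⟪y, n⟫_ℝ ∧ ⟪y, n⟫_ℝ ≤ q}) ∪ (B ∩ {y : E3 | q < ⟪y, n⟫_ℝ})) ∪
      (B ∩ {y : E3 | ⟪y, n⟫_ℝ < -q}) := by
    ext y
    simp only [mem_union, mem_inter_iff, mem_setOf_eq]
    constructor
    · intro hy
      by_cases h1 : q < ⟪y, n⟫_ℝ
      · exact Or.inl (Or.inr ⟨hy, h1⟩)
      by_cases h2 : ⟪y, n⟫_ℝ < -q
      · exact Or.inr ⟨hy, h2⟩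
      · exact Or.inl (Or.inl ⟨hy, not_lt.1 h2, not_lt.1 h1⟩)
    · rintro ((⟨hy, -⟩ | ⟨hy, -⟩) | ⟨hy, -⟩) <;> exact hy
  calc volume (B ∩ {y : E3 | -q ≤ ⟪y, n⟫_ℝ ∧ ⟪y, n⟫_ℝ ≤ q}) + 2 * volume (B ∩ {y : E3 | q < ⟪y, n⟫_ℝ})
      = volume (B ∩ {y : E3 | -q ≤ ⟪y, n⟫_ℝ ∧ ⟪y, n⟫_ℝ ≤ q}) + volume (B ∩ {y : E3 | q < ⟪y, n⟫_ℝ}) +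
          volume (B ∩ {y : E3 | ⟪y, n⟫_ℝ < -q}) := by rw [two_mul, hvol, add_assoc]
    _ = volume (((B ∩ {y : E3 | -q ≤ ⟪y, n⟫_ℝ ∧ ⟪y, n⟫_ℝ ≤ q}) ∪ (B ∩ {y : E3 | q < ⟪y, n⟫_ℝ})) ∪
          (B ∩ {y : E3 | ⟪y, n⟫_ℝ < -q})) := by
        rw [measure_union hd2 hm2, measure_union hd1 hm1]
    _ = volume B := by rw [← hpart]

end Summit.Ventures.Crystal3D.Theorems

end
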